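import Summits.QuantumFields.BalabanUV.Beta.RemainderExplicitHistoryDiagonalComparison
import Summits.QuantumFields.BalabanUV.Beta.RemainderExplicitHistoryDiagonalRatePowerTail

/-!
# RemainderExplicitHistoryDiagonalRateUniform — ROAD P3, ORDER-0 PROFILE FAMILY: THE RATE IN THE CUTOFF WITH ONE CONSTANT AT EVERY INFRARED
# DISTANCE, AND THE LOWER SIDE POINTWISE — below the threshold distance `σ₀` the third file's rate holds with the extra factor `b∕(b − Wγ)` ONLY
# (not `(1 + Wγ³∕2)^{σ₀−m}`), and the fourth file's «some `m′ ≤ m`» lower bounds hold AT `m` with the same factor: borderline profile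
# `√m∕√n ≲ astar g m − invSq g m n ≲ √m∕√n`, power tails ∕ profiles `√m∕n^q` likewise, pointwise in `m`
# (second file of station S-d4p3-g50-1 «the matched discrepancy is comparable along the run: uniform threshold and the pointwise lower side»)

Cell `pub-balaban`, β-function sub-cell, BINDER row D4 «RemainderConst leaves for Bałaban's split» (`HOME/BINDER-OWNERS.md`; owner
lineage `b2b-balaban-beta-an4`; this file by co-owner #3 lineage `b2b-balaban-beta-d4-p3`, road P3 «the reduction road», generation 50,
station S-d4p3-g50-1, second file; imports the station's first file `RemainderExplicitHistoryDiagonalComparison` and generation 49's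
`RemainderExplicitHistoryDiagonalRatePowerTail`), β-FLOW TEAM duty (1); FREEZE (0) honoured (def-free module in road P3's own
`RemainderExplicit*` series; no leaf, no interface, no Literature file).  SOURCE OF THE SHAPES ONLY: [Balaban1987RG1] (0.20) p. 256, (0.31)
and Thm 2 p. 259, §5 p. 298.  Pure real analysis about ONE explicit toy family (ours, not Bałaban's).

HONEST FRAMING (page 1 of everything the β sub-cell writes).  *"Discharging BetaPertH makes Bałaban's UV stability UNCONDITIONAL — a real
constructive-QFT result; it is NOT the continuum limit and NOT the Clay problem."*  THIS FILE DISCHARGES NOTHING OF THE KIND.  It reads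
the first file's comparison `astar g m′ − invSq g m′ (n+m−m′) ≤ (astar g m − invSq g m n)∕(1 − Wγ∕b)` (`m′ ≤ m`, `Wγ < b`) into generation
49's rate theorems: (§1) the sixth file's threshold theorems with the factor `(1 + Wγ³∕2)^{σ₀−m}` replaced by `1∕(1 − Wγ∕b)` — a constant the
third file's `Λ` already contains, so the threshold distance costs NOTHING beyond the letters of the rate itself; (§2) the fourth ∕ fifth ∕
eighth files' lower sides, stated for SOME `m′ ≤ m`, now AT `m` (at the price `1∕(1 − Wγ∕b)`: the lower side was smallness-free for the
running maximum and stays so there); (§3) END: the borderline family of generation 49 with its rate TWO-SIDED AND POINTWISE,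
`c₁·√m∕√(n+m+1) ≤ astar g m − invSq g m n ≤ c₂·√m∕√(n+2)`.  Nothing of Bałaban's (1.22) is asserted or constructed; row D4 class UNCHANGED
(critical-path width 0; instance 0∕1; D4 DISCHARGE NO DATE); NOT B12 Thm 2, NOT BetaPertH, NOT continuum, NOT Clay.  HONEST DEPENDENCY:
continuum YM on T⁴ ⇐ BetaPertH ∧ nine spine estimates (0/9 proved); BetaPertH ⇐ (D1) ∧ (D4) ∧ CAP+tail; G-an2-4 gates asym, D1 and
NE2/3/4.  ABSOLUTE RULE: nothing is cited as a fact.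

WHAT IS PROVED ([folklore]; 0 sorry; 0 `def`).
* §1 **`astar_sub_invSq_le_rate_uniform`** (τ-class of the third file, threshold distance `σ₀` with `A₂ ≤ b√b√σ₀`; `m ≤ σ₀`, `2σ₀ ≤ n+m+1` ⇒
  `astar g m − invSq g m n ≤ Λ√σ₀·τ(n+m+1−σ₀)∕(1 − Wγ∕b)`), `borderline_rate_uniform`, `powerTail_rate_uniform`, `powerProfile_rate_uniform`.
* §2 **`astar_sub_invSq_rate_lower_pointwise`** (τ′-class of the fourth file + `Wγ < b`; `1 ≤ m ≤ n+1` ⇒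
  `√m·τ′(n+m) ≤ 8κ₂√b₂(1+Wγ∕b)·(astar g m − invSq g m n)∕(1 − Wγ∕b)`), `borderline_rate_lower_pointwise`, `powerTail_rate_lower_pointwise`,
  `powerProfile_rate_lower_pointwise`.
* §3 END **`exists_family_borderline_rate_pointwise`**.
All letters NOT-IN-PRINT; `BetaFlowAsPrinted S` records a Markov β_n only ⇒ no junction of the as-printed interface changes.
-/

noncomputable section

open Finset Filter Topology

namespace Summit.QuantumFields.BalabanUV.Beta.RemainderExplicitHistoryDiagonalRateUniform

open Literature.MathematicalPhysics.QuantumFieldTheory.Balaban1983to89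
open Literature.MathematicalPhysics.QuantumFieldTheory.Balaban1983to89.FlowStep
open Literature.MathematicalPhysics.QuantumFieldTheory.Balaban1983to89.T4CouplingMatching
open Literature.MathematicalPhysics.QuantumFieldTheory.Balaban1983to89.T4ContinuumCoupling
open Summit.QuantumFields.BalabanUV.Beta.RemainderExplicitHistoryDiagonalComparison
open Summit.QuantumFields.BalabanUV.Beta.RemainderExplicitHistoryDiagonalRate
open Summit.QuantumFields.BalabanUV.Beta.RemainderExplicitHistoryDiagonalRateLower
open Summit.QuantumFields.BalabanUV.Beta.RemainderExplicitHistoryDiagonalRateBorderline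
open Summit.QuantumFields.BalabanUV.Beta.RemainderExplicitHistoryDiagonalRatePowerShapes (powerTail_T1 powerTail_T2)
open Summit.QuantumFields.BalabanUV.Beta.RemainderExplicitHistoryDiagonalRatePowerTail
open Summit.QuantumFields.BalabanUV.Beta.RemainderExplicitHistoryDiagonalExamples (borderline_sum_le)

variable {β : HBeta} {b γ W A₁ A₂ M : ℝ} {ρ τ : ℕ → ℝ}

/-! ## §1 The rate at every infrared distance below the threshold, with one constant -/

/-- **ROAD P3 — THE RATE IN THE CUTOFF BELOW THE THRESHOLD COSTS ONLY `b∕(b − Wγ)`.**  A pinned family of runs of the order-0 profile family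
in ]0,γ] with the hypotheses of the third file's `astar_sub_invSq_le_rate` (tail majorant `τ` of polynomial type, `Wγ < b`), and a threshold
distance `σ₀` with `A₂ ≤ b√b·√σ₀`.  THEN for every `m ≤ σ₀` and every cutoff `n` with `2σ₀ ≤ n + m + 1`:
`0 ≤ astar g m − invSq g m n ≤ Λ·√σ₀·τ(n+m+1−σ₀) ∕ (1 − Wγ∕b)`, `Λ = 4∕√b + 8√2κA₁∕((1−Wγ∕b)√b)` — the third file at the distance `σ₀` of the same
run (`n + m` steps), carried to `m` by the first file's `astar_sub_invSq_comparison`; compare the sixth file's `(1 + Wγ³∕2)^{σ₀−m}`.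
[cite: Balaban1987RG1, (0.20) p.256, (0.31) and Thm 2 p.259] -/
theorem astar_sub_invSq_le_rate_uniform
    (hβ : ∀ (k : ℕ) (p : Fin (k + 1) → ℝ),
      β k p = b + ∑ i : Fin (k + 1), ρ (k - i) * min (p (Fin.last k)) (|p (Fin.last k) - p i|))
    (hb : 0 < b) (hγ : 0 < γ) (hρ0 : ∀ a, 0 ≤ ρ a) (hρW : ∀ n, ∑ a ∈ range n, ρ a ≤ W) (hsmall : W * γ < b)
    (hτ0 : ∀ k, 0 ≤ τ k) (hτmono : ∀ k l, k ≤ l → τ l ≤ τ k)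
    (hτ : ∀ k N, k ≤ N → ∑ a ∈ range N, ρ a - ∑ a ∈ range k, ρ a ≤ τ k) (hA₁ : 0 ≤ A₁)
    (hUV : ∀ K N : ℕ, 1 ≤ K → ∑ a ∈ range N, ρ a * (min (a : ℝ) K) ^ 2 ≤ A₁ * (K : ℝ) ^ 2 * τ K)
    (hT2 : ∀ j₀ : ℕ, ∑ i ∈ range j₀, τ (i + 1) * τ (j₀ - i) / ((j₀ + 1 - i : ℕ) : ℝ) ≤ A₂ * τ (j₀ + 1))
    {g : ℕ → ℕ → ℝ} {gIR : ℝ} (hrun : ∀ K, RGEqH K β (g K)) (hbox : ∀ K i, i ≤ K → 0 < g K i ∧ g K i ≤ γ)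
    (hpin : ∀ K, g K K = gIR) {σ₀ m n : ℕ} (hσ₀ : A₂ ≤ b * Real.sqrt b * Real.sqrt (σ₀ : ℝ)) (hm : m ≤ σ₀)
    (hn : 2 * σ₀ ≤ n + m + 1) :
    0 ≤ astar g m - invSq g m n ∧ astar g m - invSq g m n
      ≤ (4 / Real.sqrt b + 8 * Real.sqrt 2 * ((b + W * γ) / b) * A₁ / ((1 - W * γ / b) * Real.sqrt b))
          * Real.sqrt (σ₀ : ℝ) * τ (n + m + 1 - σ₀) / (1 - W * γ / b) := by
  have hc : 0 < 1 - W * γ / b := by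
    have : W * γ / b < 1 := (div_lt_one hb).mpr hsmall
    linarith
  -- the first file's comparison on the run with `n + m` steps, between the distances `m ≤ σ₀`
  have hcmp := astar_sub_invSq_comparison hβ hb hγ hρ0 hρW hsmall hrun hbox hpin hm (n + m - σ₀)
  rw [show n + m - σ₀ + σ₀ - m = n by omega] at hcmp
  -- the third file at the distance `σ₀`
  have hrate := astar_sub_invSq_le_rate hβ hb hγ hρ0 hρW hsmall hτ0 hτmono hτ hA₁ hUV hT2 hrun hbox hpin hσ₀
    (show σ₀ ≤ n + m - σ₀ + 1 by omega)
  rw [show n + m - σ₀ + 1 = n + m + 1 - σ₀ by omega] at hrate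
  exact ⟨hcmp.1, hcmp.2.trans (div_le_div_of_nonneg_right hrate.2 hc.le)⟩

/-- **THE BORDERLINE RATE AT EVERY INFRARED DISTANCE BELOW THE THRESHOLD, ONE CONSTANT.**  The borderline profile `ρ(a) = M∕((a+1)√(a+1))`
(`M > 0`, `Σ_{a<N} ρ_a ≤ W`, `Wγ < b`), threshold `18√2·M ≤ b√b·√σ₀`; for every `m ≤ σ₀` and `n` with `2σ₀ ≤ n + m + 1`:
`astar g m − invSq g m n ≤ Λ·√σ₀·3M∕√(n+m+2−σ₀) ∕ (1 − Wγ∕b)`, `Λ = 4∕√b + 24√2κ∕((1−Wγ∕b)√b)`. [cite: Balaban1987RG1, (0.20) p.256, (0.31) and Thm 2 p.259] -/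
theorem borderline_rate_uniform
    (hβ : ∀ (k : ℕ) (p : Fin (k + 1) → ℝ),
      β k p = b + ∑ i : Fin (k + 1), ρ (k - i) * min (p (Fin.last k)) (|p (Fin.last k) - p i|))
    (hb : 0 < b) (hγ : 0 < γ) (hM : 0 < M) (hρ : ∀ a, ρ a = M / (((a : ℝ) + 1) * Real.sqrt ((a : ℝ) + 1)))
    (hρW : ∀ n, ∑ a ∈ range n, ρ a ≤ W) (hsmall : W * γ < b)
    {g : ℕ → ℕ → ℝ} {gIR : ℝ} (hrun : ∀ K, RGEqH K β (g K)) (hbox : ∀ K i, i ≤ K → 0 < g K i ∧ g K i ≤ γ)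
    (hpin : ∀ K, g K K = gIR) {σ₀ m n : ℕ} (hσ₀ : 18 * Real.sqrt 2 * M ≤ b * Real.sqrt b * Real.sqrt (σ₀ : ℝ)) (hm : m ≤ σ₀)
    (hn : 2 * σ₀ ≤ n + m + 1) :
    0 ≤ astar g m - invSq g m n ∧ astar g m - invSq g m n
      ≤ (4 / Real.sqrt b + 8 * Real.sqrt 2 * ((b + W * γ) / b) * 3 / ((1 - W * γ / b) * Real.sqrt b))
          * Real.sqrt (σ₀ : ℝ) * (3 * M / Real.sqrt (((n + m + 1 - σ₀ : ℕ) : ℝ) + 1)) / (1 - W * γ / b) := by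
  have hρ0 : ∀ a, 0 ≤ ρ a := fun a => by rw [hρ a]; positivity
  have hτ0 : ∀ k : ℕ, 0 ≤ 3 * M / Real.sqrt ((k : ℝ) + 1) := fun k => by positivity
  have hτmono : ∀ k l : ℕ, k ≤ l → 3 * M / Real.sqrt ((l : ℝ) + 1) ≤ 3 * M / Real.sqrt ((k : ℝ) + 1) := by
    intro k l hkl
    exact div_le_div_of_nonneg_left (by positivity) (Real.sqrt_pos.2 (by positivity))
      (Real.sqrt_le_sqrt (by exact_mod_cast Nat.add_le_add_right hkl 1))
  exact astar_sub_invSq_le_rate_uniform (τ := fun k => 3 * M / Real.sqrt ((k : ℝ) + 1)) (A₁ := 3) (A₂ := 18 * Real.sqrt 2 * M)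
    hβ hb hγ hρ0 hρW hsmall hτ0 hτmono (fun k N hkN => borderline_tail_le hM.le hρ hkN) (by norm_num)
    (fun K N hK => borderline_T1 hM.le hρ K N hK) (fun j₀ => borderline_T2 M j₀) hrun hbox hpin hσ₀ hm hn

/-- **EVERY POWER TAIL BELOW THE THRESHOLD, ONE CONSTANT.**  Tail majorant `T₀∕(k+1)^q` (`0 < q < 1`, `T₀ ≥ 0`), `Wγ < b`, threshold
`T₀(4∕(1−q) + 2∕q) ≤ b√b·√σ₀`; for `m ≤ σ₀`, `2σ₀ ≤ n+m+1`: `astar g m − invSq g m n ≤ Λ₄√σ₀·T₀∕(n+m+2−σ₀)^q ∕ (1 − Wγ∕b)`,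
`Λ₄ = 4∕√b + 32√2κ∕((1−Wγ∕b)√b)`. [cite: Balaban1987RG1, (0.20) p.256, (0.31) and Thm 2 p.259] -/
theorem powerTail_rate_uniform {T₀ q : ℝ}
    (hβ : ∀ (k : ℕ) (p : Fin (k + 1) → ℝ),
      β k p = b + ∑ i : Fin (k + 1), ρ (k - i) * min (p (Fin.last k)) (|p (Fin.last k) - p i|))
    (hb : 0 < b) (hγ : 0 < γ) (hρ0 : ∀ a, 0 ≤ ρ a) (hρW : ∀ n, ∑ a ∈ range n, ρ a ≤ W) (hsmall : W * γ < b)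
    (hq0 : 0 < q) (hq1 : q < 1) (hT₀ : 0 ≤ T₀)
    (hτ : ∀ k N : ℕ, k ≤ N → ∑ a ∈ range N, ρ a - ∑ a ∈ range k, ρ a ≤ T₀ / ((k : ℝ) + 1) ^ q)
    {g : ℕ → ℕ → ℝ} {gIR : ℝ} (hrun : ∀ K, RGEqH K β (g K)) (hbox : ∀ K i, i ≤ K → 0 < g K i ∧ g K i ≤ γ)
    (hpin : ∀ K, g K K = gIR) {σ₀ m n : ℕ} (hσ₀ : T₀ * (4 / (1 - q) + 2 / q) ≤ b * Real.sqrt b * Real.sqrt (σ₀ : ℝ))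
    (hm : m ≤ σ₀) (hn : 2 * σ₀ ≤ n + m + 1) :
    0 ≤ astar g m - invSq g m n ∧ astar g m - invSq g m n
      ≤ (4 / Real.sqrt b + 8 * Real.sqrt 2 * ((b + W * γ) / b) * 4 / ((1 - W * γ / b) * Real.sqrt b))
          * Real.sqrt (σ₀ : ℝ) * (T₀ / ((((n + m + 1 - σ₀ : ℕ) : ℝ)) + 1) ^ q) / (1 - W * γ / b) :=
  astar_sub_invSq_le_rate_uniform (τ := fun k => T₀ / ((k : ℝ) + 1) ^ q) (A₁ := 4) (A₂ := T₀ * (4 / (1 - q) + 2 / q))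
    hβ hb hγ hρ0 hρW hsmall (fun k => by positivity) (fun _ _ hkl => powerTail_antitone hT₀ hq0.le hkl) hτ (by norm_num)
    (fun K N hK => powerTail_T1 hq0 hq1 hT₀ hτ K N hK) (fun j₀ => powerTail_T2 hq0 hq1 j₀) hrun hbox hpin hσ₀ hm hn

/-- THE POWER PROFILE `ρ(a) = M₀∕((a+1)^q(a+1))` (`M₀ > 0`, `0 < q < 1`) BELOW ITS THRESHOLD `M₀(1+2∕q)(4∕(1−q)+2∕q) ≤ b√b√σ₀`, ONE CONSTANT:
`astar g m − invSq g m n ≤ Λ₄√σ₀·M₀(1+2∕q)∕(n+m+2−σ₀)^q ∕ (1 − Wγ∕b)` for `m ≤ σ₀`, `2σ₀ ≤ n+m+1`. [cite: Balaban1987RG1, (0.20) p.256, (0.31) and Thm 2 p.259] -/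
theorem powerProfile_rate_uniform {M₀ q : ℝ}
    (hβ : ∀ (k : ℕ) (p : Fin (k + 1) → ℝ),
      β k p = b + ∑ i : Fin (k + 1), ρ (k - i) * min (p (Fin.last k)) (|p (Fin.last k) - p i|))
    (hb : 0 < b) (hγ : 0 < γ) (hM₀ : 0 < M₀) (hq0 : 0 < q) (hq1 : q < 1)
    (hρ : ∀ a, ρ a = M₀ / ((((a : ℝ) + 1) ^ q) * ((a : ℝ) + 1)))
    (hρW : ∀ n, ∑ a ∈ range n, ρ a ≤ W) (hsmall : W * γ < b)
    {g : ℕ → ℕ → ℝ} {gIR : ℝ} (hrun : ∀ K, RGEqH K β (g K)) (hbox : ∀ K i, i ≤ K → 0 < g K i ∧ g K i ≤ γ)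
    (hpin : ∀ K, g K K = gIR) {σ₀ m n : ℕ}
    (hσ₀ : M₀ * (1 + 2 / q) * (4 / (1 - q) + 2 / q) ≤ b * Real.sqrt b * Real.sqrt (σ₀ : ℝ)) (hm : m ≤ σ₀)
    (hn : 2 * σ₀ ≤ n + m + 1) :
    0 ≤ astar g m - invSq g m n ∧ astar g m - invSq g m n
      ≤ (4 / Real.sqrt b + 8 * Real.sqrt 2 * ((b + W * γ) / b) * 4 / ((1 - W * γ / b) * Real.sqrt b))
          * Real.sqrt (σ₀ : ℝ) * (M₀ * (1 + 2 / q) / ((((n + m + 1 - σ₀ : ℕ) : ℝ)) + 1) ^ q) / (1 - W * γ / b) := by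
  have hρ0 : ∀ a, 0 ≤ ρ a := fun a => by rw [hρ a]; positivity
  have hT₀ : 0 ≤ M₀ * (1 + 2 / q) := by positivity
  exact powerTail_rate_uniform hβ hb hγ hρ0 hρW hsmall hq0 hq1 hT₀
    (fun k N hkN => powerProfile_tail_le hM₀.le hq0 hq1.le hρ hkN) hrun hbox hpin hσ₀ hm hn

/-! ## §2 The lower side, pointwise in the infrared distance -/

/-- **ROAD P3 — THE LOWER SIDE OF THE RATE, POINTWISE.**  A pinned family of runs of the order-0 profile family in ]0,γ] (`b > 0`, `γ > 0`,
`ρ ≥ 0`, `Σ_{a<N} ρ_a ≤ W`) with a tail MINORANT `τ′` as in the fourth file (`τ′` non-increasing, `τ′(k) ≤ Σ_{a∈[k,N)} ρ_a` for `k ≥ 1`, `N ≥ 2k`)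
and the ultraviolet-half smallness `Wγ < b`.  THEN for all `1 ≤ m ≤ n + 1`:
`√m·τ′(n+m) ≤ 8κ₂√b₂(1 + Wγ∕b) · (astar g m − invSq g m n)∕(1 − Wγ∕b)` (`b₂ = 1∕g_IR² + b + Wγ`, `κ₂ = b₂∕b`) — the fourth file's
`astar_sub_invSq_rate_lower` gives this for SOME `m′ ≤ m` in place of `m`, and the first file's comparison moves it to `m`.
[cite: Balaban1987RG1, (0.20) p.256, (0.31) and Thm 2 p.259] -/
theorem astar_sub_invSq_rate_lower_pointwise {τ' : ℕ → ℝ}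
    (hβ : ∀ (k : ℕ) (p : Fin (k + 1) → ℝ),
      β k p = b + ∑ i : Fin (k + 1), ρ (k - i) * min (p (Fin.last k)) (|p (Fin.last k) - p i|))
    (hb : 0 < b) (hγ : 0 < γ) (hρ0 : ∀ a, 0 ≤ ρ a) (hρW : ∀ n, ∑ a ∈ range n, ρ a ≤ W) (hsmall : W * γ < b)
    (hτ'mono : ∀ k l, k ≤ l → τ' l ≤ τ' k)
    (hτ' : ∀ k N, 1 ≤ k → 2 * k ≤ N → τ' k ≤ ∑ a ∈ range N, ρ a - ∑ a ∈ range k, ρ a)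
    {g : ℕ → ℕ → ℝ} {gIR : ℝ} (hrun : ∀ K, RGEqH K β (g K)) (hbox : ∀ K i, i ≤ K → 0 < g K i ∧ g K i ≤ γ)
    (hpin : ∀ K, g K K = gIR) {m n : ℕ} (hm : 1 ≤ m) (hmn : m ≤ n + 1) :
    Real.sqrt (m : ℝ) * τ' (n + m)
      ≤ 8 * ((1 / gIR ^ 2 + (b + W * γ)) / b) * Real.sqrt (1 / gIR ^ 2 + (b + W * γ)) * (1 + W * γ / b)
          * ((astar g m - invSq g m n) / (1 - W * γ / b)) := by
  have hW : 0 ≤ W := by simpa using hρW 0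
  have hgIR : 0 < gIR := by rw [← hpin 0]; exact (hbox 0 0 le_rfl).1
  obtain ⟨m', hm', h⟩ := astar_sub_invSq_rate_lower hβ hb hγ hρ0 hρW hτ'mono hτ' hrun hbox hpin hm hmn
  have hcmp := (astar_sub_invSq_comparison hβ hb hγ hρ0 hρW hsmall hrun hbox hpin hm' n).2
  exact h.trans (mul_le_mul_of_nonneg_left hcmp (by positivity))

/-- **THE BORDERLINE LOWER SIDE, POINTWISE**: `ρ(a) = M∕((a+1)√(a+1))` (`M > 0`, `Σ_{a<N} ρ_a ≤ W`, `Wγ < b`); for `1 ≤ m ≤ n+1`: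
`√m·M∕(3√(n+m+1)) ≤ 8κ₂√b₂(1+Wγ∕b)·(astar g m − invSq g m n)∕(1 − Wγ∕b)`. [cite: Balaban1987RG1, (0.20) p.256, (0.31) and Thm 2 p.259] -/
theorem borderline_rate_lower_pointwise
    (hβ : ∀ (k : ℕ) (p : Fin (k + 1) → ℝ),
      β k p = b + ∑ i : Fin (k + 1), ρ (k - i) * min (p (Fin.last k)) (|p (Fin.last k) - p i|))
    (hb : 0 < b) (hγ : 0 < γ) (hM : 0 < M) (hρ : ∀ a, ρ a = M / (((a : ℝ) + 1) * Real.sqrt ((a : ℝ) + 1)))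
    (hρW : ∀ n, ∑ a ∈ range n, ρ a ≤ W) (hsmall : W * γ < b)
    {g : ℕ → ℕ → ℝ} {gIR : ℝ} (hrun : ∀ K, RGEqH K β (g K)) (hbox : ∀ K i, i ≤ K → 0 < g K i ∧ g K i ≤ γ)
    (hpin : ∀ K, g K K = gIR) {m n : ℕ} (hm : 1 ≤ m) (hmn : m ≤ n + 1) :
    Real.sqrt (m : ℝ) * (M / (3 * Real.sqrt (((n + m : ℕ) : ℝ) + 1)))
      ≤ 8 * ((1 / gIR ^ 2 + (b + W * γ)) / b) * Real.sqrt (1 / gIR ^ 2 + (b + W * γ)) * (1 + W * γ / b)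
          * ((astar g m - invSq g m n) / (1 - W * γ / b)) := by
  have hρ0 : ∀ a, 0 ≤ ρ a := fun a => by rw [hρ a]; positivity
  have hτ'mono : ∀ k l : ℕ, k ≤ l → M / (3 * Real.sqrt ((l : ℝ) + 1)) ≤ M / (3 * Real.sqrt ((k : ℝ) + 1)) := by
    intro k l hkl
    exact div_le_div_of_nonneg_left hM.le (by positivity) (mul_le_mul_of_nonneg_left
      (Real.sqrt_le_sqrt (by exact_mod_cast Nat.add_le_add_right hkl 1)) (by norm_num))
  exact astar_sub_invSq_rate_lower_pointwise (τ' := fun k => M / (3 * Real.sqrt ((k : ℝ) + 1))) hβ hb hγ hρ0 hρW hsmall hτ'mono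
    (fun k N hk hkN => borderline_tail_ge hM.le hρ hk hkN) hrun hbox hpin hm hmn

/-- **EVERY POWER-TAIL MINORANT, POINTWISE**: `T₁∕(k+1)^q ≤ Σ_{a∈[k,N)} ρ_a` for `k ≥ 1`, `N ≥ 2k` (`q ≥ 0`, `T₁ ≥ 0`), `Wγ < b`; for
`1 ≤ m ≤ n+1`: `√m·T₁∕(n+m+1)^q ≤ 8κ₂√b₂(1+Wγ∕b)·(astar g m − invSq g m n)∕(1 − Wγ∕b)`. [cite: Balaban1987RG1, (0.20) p.256, (0.31) and Thm 2 p.259] -/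
theorem powerTail_rate_lower_pointwise {T₁ q : ℝ}
    (hβ : ∀ (k : ℕ) (p : Fin (k + 1) → ℝ),
      β k p = b + ∑ i : Fin (k + 1), ρ (k - i) * min (p (Fin.last k)) (|p (Fin.last k) - p i|))
    (hb : 0 < b) (hγ : 0 < γ) (hρ0 : ∀ a, 0 ≤ ρ a) (hρW : ∀ n, ∑ a ∈ range n, ρ a ≤ W) (hsmall : W * γ < b)
    (hq : 0 ≤ q) (hT₁ : 0 ≤ T₁)
    (hτ' : ∀ k N : ℕ, 1 ≤ k → 2 * k ≤ N → T₁ / ((k : ℝ) + 1) ^ q ≤ ∑ a ∈ range N, ρ a - ∑ a ∈ range k, ρ a)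
    {g : ℕ → ℕ → ℝ} {gIR : ℝ} (hrun : ∀ K, RGEqH K β (g K)) (hbox : ∀ K i, i ≤ K → 0 < g K i ∧ g K i ≤ γ)
    (hpin : ∀ K, g K K = gIR) {m n : ℕ} (hm : 1 ≤ m) (hmn : m ≤ n + 1) :
    Real.sqrt (m : ℝ) * (T₁ / ((((n + m : ℕ) : ℝ)) + 1) ^ q)
      ≤ 8 * ((1 / gIR ^ 2 + (b + W * γ)) / b) * Real.sqrt (1 / gIR ^ 2 + (b + W * γ)) * (1 + W * γ / b)
          * ((astar g m - invSq g m n) / (1 - W * γ / b)) :=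
  astar_sub_invSq_rate_lower_pointwise (τ' := fun k => T₁ / ((k : ℝ) + 1) ^ q) hβ hb hγ hρ0 hρW hsmall
    (fun _ _ hkl => powerTail_antitone hT₁ hq hkl) hτ' hrun hbox hpin hm hmn

/-- **THE POWER PROFILE `ρ(a) = M₀∕((a+1)^q(a+1))`, LOWER SIDE POINTWISE** (`M₀ > 0`, `0 ≤ q ≤ 1`, `Σ_{a<N} ρ_a ≤ W`, `Wγ < b`): for `1 ≤ m ≤ n+1`,
`√m·(M₀∕4)∕(n+m+1)^q ≤ 8κ₂√b₂(1+Wγ∕b)·(astar g m − invSq g m n)∕(1 − Wγ∕b)`.  With `powerProfile_rate`: the continuum coupling of road P3's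
polynomial profiles is reached at the two-sided rate `√m∕n^q` AT EVERY infrared distance `m` above the threshold, not only at the worst one.
[cite: Balaban1987RG1, (0.20) p.256, (0.31) and Thm 2 p.259] -/
theorem powerProfile_rate_lower_pointwise {M₀ q : ℝ}
    (hβ : ∀ (k : ℕ) (p : Fin (k + 1) → ℝ),
      β k p = b + ∑ i : Fin (k + 1), ρ (k - i) * min (p (Fin.last k)) (|p (Fin.last k) - p i|))
    (hb : 0 < b) (hγ : 0 < γ) (hM₀ : 0 < M₀) (hq0 : 0 ≤ q) (hq1 : q ≤ 1)
    (hρ : ∀ a, ρ a = M₀ / ((((a : ℝ) + 1) ^ q) * ((a : ℝ) + 1)))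
    (hρW : ∀ n, ∑ a ∈ range n, ρ a ≤ W) (hsmall : W * γ < b)
    {g : ℕ → ℕ → ℝ} {gIR : ℝ} (hrun : ∀ K, RGEqH K β (g K)) (hbox : ∀ K i, i ≤ K → 0 < g K i ∧ g K i ≤ γ)
    (hpin : ∀ K, g K K = gIR) {m n : ℕ} (hm : 1 ≤ m) (hmn : m ≤ n + 1) :
    Real.sqrt (m : ℝ) * (M₀ / 4 / ((((n + m : ℕ) : ℝ)) + 1) ^ q)
      ≤ 8 * ((1 / gIR ^ 2 + (b + W * γ)) / b) * Real.sqrt (1 / gIR ^ 2 + (b + W * γ)) * (1 + W * γ / b)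
          * ((astar g m - invSq g m n) / (1 - W * γ / b)) := by
  have hρ0 : ∀ a, 0 ≤ ρ a := fun a => by rw [hρ a]; positivity
  exact powerTail_rate_lower_pointwise hβ hb hγ hρ0 hρW hsmall hq0 (by positivity : 0 ≤ M₀ / 4)
    (fun k N hk hkN => powerProfile_tail_ge hM₀.le hq0 hq1 hρ hk hkN) hrun hbox hpin hm hmn

/-! ## §3 END — a borderline family with its rate two-sided and pointwise -/

/-- **END — A BORDERLINE FAMILY WITH ITS RATE TWO-SIDED AT EVERY INFRARED DISTANCE.**  For the borderline profile `ρ(a) = M∕((a+1)√(a+1))`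
(`M > 0`) and `b > 0`, `γ > 0` with `6Mγ ≤ b`, `g_IR ∈ ]0,γ]` (`W = 3M`, so `Wγ ≤ b∕2 < b`): there is a pinned family of runs of the order-0
profile family such that AT EVERY infrared distance `m` with `18√2M ≤ b√b√m` and every cutoff `n ≥ m − 1`, BOTH
`astar g m − invSq g m n ≤ Λ·√m·3M∕√(n+2)` AND `√m·M∕(3√(n+m+1)) ≤ 8κ₂√b₂(1+Wγ∕b)·(astar g m − invSq g m n)∕(1 − Wγ∕b)` — the same `m` on
both sides (generation 49's `exists_family_borderline_rate` had the lower side at SOME `m′ ≤ m`).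
[cite: Balaban1987RG1, (0.20) p.256, (0.31) and Thm 2 p.259] -/
theorem exists_family_borderline_rate_pointwise {M b γ gIR : ℝ} (hM : 0 < M)
    (hρ : ∀ a, ρ a = M / (((a : ℝ) + 1) * Real.sqrt ((a : ℝ) + 1)))
    (hb : 0 < b) (hγ : 0 < γ) (hsmall : 6 * M * γ ≤ b) (hgIR : 0 < gIR) (hgIRγ : gIR ≤ γ) :
    ∃ (β : HBeta) (g : ℕ → ℕ → ℝ),
      (∀ (k : ℕ) (p : Fin (k + 1) → ℝ),
          β k p = b + ∑ i : Fin (k + 1), ρ (k - i) * min (p (Fin.last k)) (|p (Fin.last k) - p i|))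
      ∧ (∀ K, RGEqH K β (g K)) ∧ (∀ K i, i ≤ K → 0 < g K i ∧ g K i ≤ γ) ∧ (∀ K, g K K = gIR)
      ∧ (∀ m n : ℕ, 18 * Real.sqrt 2 * M ≤ b * Real.sqrt b * Real.sqrt (m : ℝ) → m ≤ n + 1 →
          astar g m - invSq g m n
            ≤ (4 / Real.sqrt b + 8 * Real.sqrt 2 * ((b + 3 * M * γ) / b) * 3 / ((1 - 3 * M * γ / b) * Real.sqrt b))
              * Real.sqrt (m : ℝ) * (3 * M / Real.sqrt (((n + 1 : ℕ) : ℝ) + 1))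
          ∧ Real.sqrt (m : ℝ) * (M / (3 * Real.sqrt (((n + m : ℕ) : ℝ) + 1)))
            ≤ 8 * ((1 / gIR ^ 2 + (b + 3 * M * γ)) / b) * Real.sqrt (1 / gIR ^ 2 + (b + 3 * M * γ)) * (1 + 3 * M * γ / b)
              * ((astar g m - invSq g m n) / (1 - 3 * M * γ / b))) := by
  let β : HBeta := fun k p => b + ∑ i : Fin (k + 1), ρ (k - i) * min (p (Fin.last k)) (|p (Fin.last k) - p i|)
  have hβ : ∀ (k : ℕ) (p : Fin (k + 1) → ℝ),
      β k p = b + ∑ i : Fin (k + 1), ρ (k - i) * min (p (Fin.last k)) (|p (Fin.last k) - p i|) := fun k p => rfl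
  have hρ0 : ∀ a, 0 ≤ ρ a := fun a => by rw [hρ a]; positivity
  have hρW := borderline_sum_le hM.le hρ
  have hsmall' : (3 * M) * γ < b := by nlinarith [mul_pos hM hγ]
  obtain ⟨g, hrun, hbox, hpin⟩ :=
    RemainderExplicitHistoryDiagonalProfile.runFamily_exists (W := 3 * M) hβ hb hγ hρ0 hρW (by nlinarith [mul_pos hM hγ]) hgIR hgIRγ
  refine ⟨β, g, hβ, hrun, hbox, hpin, fun m n hm hmn => ⟨?_, ?_⟩⟩
  · exact (borderline_rate hβ hb hγ hM hρ hρW hsmall' hrun hbox hpin hm hmn).2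
  · have hm1 : 1 ≤ m := by
      by_contra h0
      have hm0 : m = 0 := by omega
      rw [hm0, Nat.cast_zero, Real.sqrt_zero, mul_zero] at hm
      have : 0 < 18 * Real.sqrt 2 * M := by positivity
      linarith
    exact borderline_rate_lower_pointwise hβ hb hγ hM hρ hρW hsmall' hrun hbox hpin hm1 hmn

end Summit.QuantumFields.BalabanUV.Beta.RemainderExplicitHistoryDiagonalRateUniform

end
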